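import Summits.Parity.BatemanHorn.Theorems.SoloInformedErdosNairClassI

/-!
# Erdős's bound `∑_{n ≤ N} τ(|g(n)|) ≪ N log N`: preparations for Shiu's class IV

Solo informed line (Parity / Bateman–Horn), session 139.  Elementary lemmas for the polynomial
analogue of Shiu's class IV (`SoloInformedErdosNairClassIV`): the per-`c` algebra bringing the
sifted-fibre count to the Erdős–Nair weight `h_g(c)/c`; the comparison
`∏_{p ≤ z}(1 − ρ_g(p)/p) ≤ ∏_{p<v}(1 − ρ_g(p)/p)` for `v ≤ z`; and the real-variable facts about the
level `r = ⌊log z / log P⌋` of a cut prime `P ∈ (L, w]` (`z = w²`): `r ≥ 2`, `r log L ≤ log z`, the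
window `z^{1/(r+1)} < P ≤ z^{1/r}`, and the parameters `u = z^{1/(r+1)} ≥ 2`, `u ≤ z^{1/3}`,
`v = z^{1/r} ∈ [2, z]`, `η = K₁ r / log z ∈ [0, 1/6]` with `w^{−η} = e^{−K₁ r/2}`, `v^η = e^{K₁}`,
`η log v = K₁`, `η log 4 ≤ 1` (exactly as in the proof of `Shiu.classIV_r_bound`).
Everything is PROVED; no definitions, no named facts.

References: P. Shiu, J. reine angew. Math. 313 (1980) 161–170, §5 [Shiu1980].
-/

open Finset Real Polynomial

namespace Summit.Parity.BatemanHorn.Theorems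

open Literature.NumberTheory.Sieve

namespace ErdosDivisor

/-- Per-`c` algebra of classes I and IV: `τ(c) · ρ(c)((N/c + 1) P E(c) + U) ≤ ((N + z)P + U z) · h/c`
with `h = τ(c)ρ(c)E(c)`, for `0 < c ≤ z`, `E(c) ≥ 1`. [folklore] -/
theorem weight_step {τ ρ E c z N P U : ℝ} (hc0 : 0 < c) (hcz : c ≤ z) (hτ0 : 0 ≤ τ) (hρ0 : 0 ≤ ρ)
    (hE1 : 1 ≤ E) (hP : 0 ≤ P) (hU : 0 ≤ U) (hN : 0 ≤ N) :
    τ * (ρ * ((N / c + 1) * (P * E) + U)) ≤ ((N + z) * P + U * z) * (τ * ρ * E / c) := by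
  set h : ℝ := τ * ρ * E / c with hh
  have hE0 : 0 ≤ E := le_trans zero_le_one hE1
  have hh0 : 0 ≤ h := div_nonneg (mul_nonneg (mul_nonneg hτ0 hρ0) hE0) hc0.le
  have hτρE : τ * ρ * E = h * c := by rw [hh, div_mul_cancel₀ _ hc0.ne']
  have hNc : (N / c + 1) * c = N + c := by field_simp
  have hLHS : τ * (ρ * ((N / c + 1) * (P * E) + U)) = (N + c) * P * h + τ * ρ * U := by
    calc τ * (ρ * ((N / c + 1) * (P * E) + U)) = (N / c + 1) * P * (τ * ρ * E) + τ * ρ * U := by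
          ring
      _ = (N / c + 1) * P * (h * c) + τ * ρ * U := by rw [hτρE]
      _ = ((N / c + 1) * c) * P * h + τ * ρ * U := by ring
      _ = (N + c) * P * h + τ * ρ * U := by rw [hNc]
  have hb1 : (N + c) * P * h ≤ (N + z) * P * h :=
    mul_le_mul_of_nonneg_right (mul_le_mul_of_nonneg_right (by linarith) hP) hh0
  have hb2 : τ * ρ * U ≤ U * z * h := by
    calc τ * ρ * U ≤ τ * ρ * U * E :=
          le_mul_of_one_le_right (mul_nonneg (mul_nonneg hτ0 hρ0) hU) hE1
      _ = U * (τ * ρ * E) := by ring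
      _ = U * (h * c) := by rw [hτρE]
      _ = U * c * h := by ring
      _ ≤ U * z * h := mul_le_mul_of_nonneg_right (mul_le_mul_of_nonneg_left hcz hU) hh0
  rw [hLHS]
  calc (N + c) * P * h + τ * ρ * U ≤ (N + z) * P * h + U * z * h := add_le_add hb1 hb2
    _ = ((N + z) * P + U * z) * h := by ring

/-- `{p < ⌈v⌉} ⊆ {p ≤ ⌊z⌋}` for `v ≤ z`. [folklore] -/
theorem primesBelow_ceil_subset_primesLE_floor {v z : ℝ} (hvz : v ≤ z) :
    Nat.primesBelow ⌈v⌉₊ ⊆ Nat.primesLE ⌊z⌋₊ := by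
  intro p hp
  rw [Nat.mem_primesBelow] at hp
  rw [Nat.mem_primesLE]
  refine ⟨Nat.le_floor ?_, hp.2⟩
  have : (p : ℝ) < v := Nat.lt_ceil.1 hp.1
  linarith

/-- `∏_{p ≤ ⌊z⌋}(1 − ρ_g(p)/p) ≤ ∏_{p < ⌈v⌉}(1 − ρ_g(p)/p)` for `v ≤ z` (all factors in `(0, 1]`).
[folklore] -/
theorem prod_primesLE_le_prod_primesBelow {g : ℤ[X]} (hg : HasNoFixedPrimeDivisor ![g]) {v z : ℝ}
    (hvz : v ≤ z) :
    ∏ p ∈ Nat.primesLE ⌊z⌋₊, (1 - (polyRootCountMod ![g] p : ℝ) / p) ≤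
      ∏ p ∈ Nat.primesBelow ⌈v⌉₊, (1 - (polyRootCountMod ![g] p : ℝ) / p) :=
  prod_le_prod_of_subset_of_le_one (primesBelow_ceil_subset_primesLE_floor hvz)
    (fun p hp => (one_sub_rho_div_pos hg (Nat.prime_of_mem_primesLE hp)).le)
    (fun p _ _ => by
      have : 0 ≤ (polyRootCountMod ![g] p : ℝ) / p := by positivity
      linarith)

/-- `0 < ∏_{p ≤ ⌊z⌋}(1 − ρ_g(p)/p)`. [folklore] -/
theorem prod_primesLE_pos {g : ℤ[X]} (hg : HasNoFixedPrimeDivisor ![g]) (z : ℝ) :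
    0 < ∏ p ∈ Nat.primesLE ⌊z⌋₊, (1 - (polyRootCountMod ![g] p : ℝ) / p) :=
  prod_pos fun _ hp => one_sub_rho_div_pos hg (Nat.prime_of_mem_primesLE hp)

/-! ### The level `r = ⌊log z / log P⌋` of a cut prime `P ∈ (L, w]` -/

/-- For `z = w²`, `w ≥ 2`, `4 ≤ L < P ≤ w` and `r = ⌊log z / log P⌋`: `r ≥ 2`,
`r log P ≤ log z < (r+1) log P` and `r log L ≤ log z`. [cite: Shiu1980, §5 (∑_IV)] -/
theorem level_facts {z w L P : ℝ} (hw : 2 ≤ w) (hwz : w * w = z) (hL : 4 ≤ L) (hLP : L < P)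
    (hPw : P ≤ w) {r : ℕ} (hr : ⌊Real.log z / Real.log P⌋₊ = r) :
    2 ≤ r ∧ (r : ℝ) * Real.log P ≤ Real.log z ∧ Real.log z < ((r : ℝ) + 1) * Real.log P ∧
      (r : ℝ) * Real.log L ≤ Real.log z := by
  have hw0 : 0 < w := by linarith
  have hz4 : 4 ≤ z := by nlinarith
  have hlogz : 0 < Real.log z := Real.log_pos (by linarith)
  have hlogw : Real.log z = 2 * Real.log w := by
    rw [← hwz, Real.log_mul hw0.ne' hw0.ne']; ring
  have hP1 : 1 < P := by linarith
  have hlogP : 0 < Real.log P := Real.log_pos hP1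
  have hlogLP : Real.log L < Real.log P := Real.log_lt_log (by linarith) hLP
  have hq0 : 0 ≤ Real.log z / Real.log P := div_nonneg hlogz.le hlogP.le
  have hr_le : (r : ℝ) ≤ Real.log z / Real.log P := by rw [← hr]; exact Nat.floor_le hq0
  have hr_lt : Real.log z / Real.log P < r + 1 := by rw [← hr]; exact Nat.lt_floor_add_one _
  refine ⟨?_, ?_, ?_, ?_⟩
  · have h2 : (2 : ℝ) ≤ Real.log z / Real.log P := by
      rw [le_div_iff₀ hlogP, hlogw]
      have := Real.log_le_log (by linarith) hPw
      linarith
    rw [← hr]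
    exact Nat.le_floor h2
  · rwa [le_div_iff₀ hlogP] at hr_le
  · rwa [div_lt_iff₀ hlogP] at hr_lt
  · have h1 : (r : ℝ) * Real.log L ≤ r * Real.log P :=
      mul_le_mul_of_nonneg_left hlogLP.le (Nat.cast_nonneg r)
    rw [le_div_iff₀ hlogP] at hr_le
    linarith

/-- The window of the cut prime at level `r`: `z^{1/(r+1)} < P ≤ z^{1/r}`. [cite: Shiu1980, §5] -/
theorem level_window {z P : ℝ} (hz : 1 < z) (hP : 1 < P) {r : ℕ} (hr0 : 0 < r)
    (hrP : (r : ℝ) * Real.log P ≤ Real.log z) (hPr : Real.log z < ((r : ℝ) + 1) * Real.log P) :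
    z ^ (1 / ((r : ℝ) + 1)) < P ∧ P ≤ z ^ (1 / (r : ℝ)) := by
  have hz0 : 0 < z := by linarith
  have hP0 : 0 < P := by linarith
  have hr0' : (0 : ℝ) < r := by exact_mod_cast hr0
  have hu0 : 0 < z ^ (1 / ((r : ℝ) + 1)) := Real.rpow_pos_of_pos hz0 _
  have hv0 : 0 < z ^ (1 / (r : ℝ)) := Real.rpow_pos_of_pos hz0 _
  have hlogu : Real.log (z ^ (1 / ((r : ℝ) + 1))) = Real.log z / (r + 1) := by
    rw [Real.log_rpow hz0]; ring
  have hlogv : Real.log (z ^ (1 / (r : ℝ))) = Real.log z / r := by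
    rw [Real.log_rpow hz0]; ring
  constructor
  · have h1 : Real.log (z ^ (1 / ((r : ℝ) + 1))) < Real.log P := by
      rw [hlogu, div_lt_iff₀ (by positivity)]; linarith
    exact (Real.log_lt_log_iff hu0 hP0).1 h1
  · have h1 : Real.log P ≤ Real.log (z ^ (1 / (r : ℝ))) := by
      rw [hlogv, le_div_iff₀ hr0']; linarith
    exact (Real.log_le_log_iff hP0 hv0).1 h1

/-- The parameters of level `r ≥ 2` with `r log L ≤ log z`, `6K₁ ≤ log L`, `L ≥ 4`, `z = w²`:
`u = z^{1/(r+1)} ∈ [2, z^{1/3}]`, `v = z^{1/r} ∈ [2, z]`, `η = K₁ r/log z ∈ [0, 1/6]`,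
`w^{−η} = e^{−K₁ r/2}`, `v^η = e^{K₁}`, `η log v = K₁`, `η log 4 ≤ 1`. [cite: Shiu1980, §5 (∑_IV)] -/
theorem level_params {z w L K₁ : ℝ} (hw : 2 ≤ w) (hwz : w * w = z) (hL : 4 ≤ L) (hK₁ : 0 ≤ K₁)
    (hLK : 6 * K₁ ≤ Real.log L) {r : ℕ} (hr2 : 2 ≤ r) (hrL : (r : ℝ) * Real.log L ≤ Real.log z) :
    2 ≤ z ^ (1 / ((r : ℝ) + 1)) ∧ z ^ (1 / ((r : ℝ) + 1)) ≤ z ^ (1 / 3 : ℝ) ∧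
      2 ≤ z ^ (1 / (r : ℝ)) ∧ z ^ (1 / (r : ℝ)) ≤ z ∧
      0 ≤ K₁ * r / Real.log z ∧ K₁ * r / Real.log z ≤ 1 / 6 ∧
      w ^ (-(K₁ * r / Real.log z)) = Real.exp (-(K₁ * r / 2)) ∧
      (z ^ (1 / (r : ℝ))) ^ (K₁ * r / Real.log z) = Real.exp K₁ ∧
      K₁ * r / Real.log z * Real.log (z ^ (1 / (r : ℝ))) = K₁ ∧
      K₁ * r / Real.log z * Real.log 4 ≤ 1 := by
  have hw0 : 0 < w := by linarith
  have hz4 : 4 ≤ z := by nlinarith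
  have hz1 : 1 ≤ z := by linarith
  have hz0 : 0 < z := by linarith
  have hlogz : 0 < Real.log z := Real.log_pos (by linarith)
  have hlogw : Real.log z = 2 * Real.log w := by
    rw [← hwz, Real.log_mul hw0.ne' hw0.ne']; ring
  have hlogL : 0 < Real.log L := Real.log_pos (by linarith)
  have hr0 : (0 : ℝ) < r := by exact_mod_cast (by omega : 0 < r)
  have hr2' : (2 : ℝ) ≤ r := by exact_mod_cast hr2
  set u : ℝ := z ^ (1 / ((r : ℝ) + 1)) with hu
  set v : ℝ := z ^ (1 / (r : ℝ)) with hv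
  set η : ℝ := K₁ * r / Real.log z with hη
  have hu0 : 0 < u := Real.rpow_pos_of_pos hz0 _
  have hv0 : 0 < v := Real.rpow_pos_of_pos hz0 _
  have hlogu : Real.log u = Real.log z / (r + 1) := by
    rw [hu, Real.log_rpow hz0]; ring
  have hlogv : Real.log v = Real.log z / r := by
    rw [hv, Real.log_rpow hz0]; ring
  have hη0 : 0 ≤ η := by positivity
  have hη6 : η ≤ 1 / 6 := by
    rw [hη, div_le_iff₀ hlogz]
    have h1 : K₁ * r * Real.log L ≤ K₁ * Real.log z := by
      rw [mul_assoc]; exact mul_le_mul_of_nonneg_left hrL hK₁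
    have h2 : K₁ * Real.log z ≤ 1 / 6 * Real.log z * Real.log L := by nlinarith
    nlinarith
  have hu2 : 2 ≤ u := by
    have hlog4 : Real.log 4 = 2 * Real.log 2 := by
      rw [show (4 : ℝ) = 2 ^ 2 by norm_num, Real.log_pow]; ring
    have hlog2z : 2 * Real.log 2 ≤ Real.log z := by
      rw [← hlog4]; exact Real.log_le_log (by norm_num) hz4
    have hlogL4 : Real.log 4 ≤ Real.log L := Real.log_le_log (by norm_num) hL
    have h1 : ((r : ℝ) + 1) * Real.log 2 ≤ Real.log z := by nlinarith [Real.log_pos one_lt_two]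
    have h2 : Real.log 2 ≤ Real.log u := by
      rw [hlogu, le_div_iff₀ (by positivity)]; linarith
    exact (Real.log_le_log_iff (by norm_num) hu0).1 h2
  have huz : u ≤ z ^ (1 / 3 : ℝ) := by
    refine Real.rpow_le_rpow_of_exponent_le hz1 ?_
    rw [div_le_div_iff₀ (by positivity) (by norm_num)]
    linarith
  have hvz : v ≤ z := by
    conv_rhs => rw [← Real.rpow_one z]
    refine Real.rpow_le_rpow_of_exponent_le hz1 ?_
    rw [div_le_one hr0]
    linarith
  have hv2 : 2 ≤ v := by
    refine hu2.trans (Real.rpow_le_rpow_of_exponent_le hz1 ?_)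
    exact div_le_div_of_nonneg_left zero_le_one hr0 (by linarith)
  have hwη : w ^ (-η) = Real.exp (-(K₁ * r / 2)) := by
    rw [Real.rpow_def_of_pos hw0]
    congr 1
    have : Real.log w = Real.log z / 2 := by rw [hlogw]; ring
    rw [this, hη]
    field_simp
  have hvη : v ^ η = Real.exp K₁ := by
    rw [Real.rpow_def_of_pos hv0, hlogv, hη]
    congr 1
    field_simp
  have hηv : η * Real.log v = K₁ := by
    rw [hlogv, hη]; field_simp
  have hη4 : η * Real.log 4 ≤ 1 := by
    have h4 : Real.log 4 ≤ 3 := by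
      have := Real.log_le_sub_one_of_pos (by norm_num : (0 : ℝ) < 4); linarith
    have : η * Real.log 4 ≤ 1 / 6 * 3 :=
      mul_le_mul hη6 h4 (Real.log_nonneg (by norm_num)) (by norm_num)
    linarith
  exact ⟨hu2, huz, hv2, hvz, hη0, hη6, hwη, hvη, hηv, hη4⟩

end ErdosDivisor

end Summit.Parity.BatemanHorn.Theorems
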